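import Summits.CriticalPhenomena.PercolationContinuityZ3.Theorems.PercNearOneGluingNoHeavyLowerTailQ7PsiSetObserverDom
import HarnessLib

/-!
# `NoHeavyLowerTail` (stmt-CriticalPhenomena-4575) — the set-observer certificate in its GLUED (Question-9) form:
# no bonus from configurations where the observer set reaches the weak relay

Support file (`--supports stmt-CriticalPhenomena-4575`), coupling seat `prim-cplus-coupling` (gen 13).  No
definitions, no named facts, no sorries.  Memo A5-COUPLING-gen13.md §1 (corrected), §3.2.

For an observer SET `N` the pre-FKG inequality (41) in the glued graph `H/N` with designation in `H` — Kozma–Nitzan's Question 9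
after the star decomposition at the observer, and prim-lf-3's "anchored q7_three" — is STRONGER than the set form landed in
`…Q7PsiSetObserverDom/Gpsi/Q9/AllWeights` (conclusion `∫_J F(C_z) ≤ ∫_J F(C_N)`): since `c ↔ b` in `H/N` iff `c ↔_H b` or
`(N ↔ c ∧ N ↔ b)`, the glued margin is the set margin minus `μ_H(N↔b, N↔c, c↮b)`.  In (GΨ) language the glued form is the
inequality RESTRICTED to `{z ↮ N}`:  `∫_{J ∩ {z↮N}} F(C_z) ≤ ∫_{J ∩ {z↮N}} F(C_N)` (on `{z ↔ N}` both clusters are glued together).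
The bookkeeping of `Q7Psi.gpsi_three_set_of_halves` proves exactly this restricted form (its pointwise observer weights sum to `1`
precisely on `J ∩ {z↮N}`; the bonus term there was added, not used).  This file records it as a certificate:
* `Q7Psi.dom_three_glued_of_halves` — `λ·Dx + μ·Dy ≤ ∫_{J∩{z↮N}} F(C_N) − ∫_{J∩{z↮N}} F(C_z)` from the two observer halves.
[cite: KozmaNitzan2024, §5.1 (pp. 31–32), Question 9 (p. 36)]
-/

namespace Summit.CriticalPhenomena.PercolationContinuityZ3.Theorems

open MeasureTheory Set Literature.Probability.LatticeModels Literature.Probability.Percolation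
open scoped Classical
open KNPreFKG BHK2006 DecisionTree LonePortSum LonePortSumGeneral

noncomputable section

namespace Q7Psi

universe u

variable {V : Type u} [Fintype V]

/-- **The glued set-observer certificate** `λ·Dx + μ·Dy ≤ ∫_{J∩{z↮N}} F(C_N) − ∫_{J∩{z↮N}} F(C_z)` from the observer halves (H_x), (H_y)
(notation of `Q7Psi.gpsi_three_set_of_halves`; `F ≥ 0` monotone; no designation hypothesis).  Proof: pointwise observer weights
`A_x = (1−t)1_{W1} + t 1_{Wz}`, `A_y = t 1_{W2} + (1−t) 1_{Wz'}` with `A_x + A_y = 1_{J ∩ {z↮N}}`, conditioning on `C_x`, `C_y`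
(`zhalf_set`), and `C_x = C_z` on `{x↔z}`. [cite: KozmaNitzan2024, §5.1 (pp. 31–32), Question 9 (p. 36)] -/
theorem dom_three_glued_of_halves (w : Sym2 V → unitInterval) (x y z : V) (N : Set V) (F : Set V → ℝ)
    (hF : ∀ S T : Set V, S ⊆ T → F S ≤ F T) (hF0 : ∀ S, 0 ≤ F S) (t lam mu : ℝ) (ht0 : 0 ≤ t) (ht1 : t ≤ 1)
    (hHx : ∀ G : Set V → ℝ, (∀ S T : Set V, S ⊆ T → G S ≤ G T) →
      lam * ∫ ω in {ω : BondConfig V | ¬ (openGraph ω).Reachable x z}, G (openCluster ω x) ∂(prodBernoulli w) ≤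
        (1 - t) * ∫ ω in {ω : BondConfig V | ∃ n ∈ N, (openGraph ω).Reachable x n} ∩
            ({ω | ∀ n ∈ N, ¬ (openGraph ω).Reachable y n} ∩ {ω | ∀ n ∈ N, ¬ (openGraph ω).Reachable z n}),
            G (openCluster ω x) ∂(prodBernoulli w) +
          t * ∫ ω in {ω : BondConfig V | ∃ n ∈ N, (openGraph ω).Reachable x n} ∩
            {ω | ∀ n ∈ N, ¬ (openGraph ω).Reachable z n}, G (openCluster ω x) ∂(prodBernoulli w))
    (hHy : ∀ G : Set V → ℝ, (∀ S T : Set V, S ⊆ T → G S ≤ G T) →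
      mu * ∫ ω in {ω : BondConfig V | ¬ (openGraph ω).Reachable y z}, G (openCluster ω y) ∂(prodBernoulli w) ≤
        t * ∫ ω in {ω : BondConfig V | ∃ n ∈ N, (openGraph ω).Reachable y n} ∩
            ({ω | ∀ n ∈ N, ¬ (openGraph ω).Reachable x n} ∩ {ω | ∀ n ∈ N, ¬ (openGraph ω).Reachable z n}),
            G (openCluster ω y) ∂(prodBernoulli w) +
          (1 - t) * ∫ ω in {ω : BondConfig V | ∃ n ∈ N, (openGraph ω).Reachable y n} ∩
            {ω | ∀ n ∈ N, ¬ (openGraph ω).Reachable z n}, G (openCluster ω y) ∂(prodBernoulli w)) :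
    lam * ((∫ ω, F (openCluster ω x) ∂(prodBernoulli w)) - ∫ ω, F (openCluster ω z) ∂(prodBernoulli w)) +
        mu * ((∫ ω, F (openCluster ω y) ∂(prodBernoulli w)) - ∫ ω, F (openCluster ω z) ∂(prodBernoulli w)) ≤
      (∫ ω in ({ω : BondConfig V | ∃ n ∈ N, (openGraph ω).Reachable x n} ∪ {ω | ∃ n ∈ N, (openGraph ω).Reachable y n}) ∩
            {ω | ∀ n ∈ N, ¬ (openGraph ω).Reachable z n}, F (⋃ n ∈ N, openCluster ω n) ∂(prodBernoulli w)) -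
        ∫ ω in ({ω : BondConfig V | ∃ n ∈ N, (openGraph ω).Reachable x n} ∪ {ω | ∃ n ∈ N, (openGraph ω).Reachable y n}) ∩
            {ω | ∀ n ∈ N, ¬ (openGraph ω).Reachable z n}, F (openCluster ω z) ∂(prodBernoulli w) := by
  classical
  set μ := prodBernoulli w with hμ
  set wt : Set (Sym2 V) → ℝ := weight (fun e => (w e : ℝ)) with hwt
  have hwt0 : ∀ ω, 0 ≤ wt ω := fun ω => weight_nonneg (fun e => (w e).2.1) (fun e => (w e).2.2) ω
  -- events
  set Ox : Set (BondConfig V) := {ω : BondConfig V | ∃ n ∈ N, (openGraph ω).Reachable x n} with hOx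
  set Oy : Set (BondConfig V) := {ω : BondConfig V | ∃ n ∈ N, (openGraph ω).Reachable y n} with hOy
  set Ex : Set (BondConfig V) := {ω | ∀ n ∈ N, ¬ (openGraph ω).Reachable x n} with hEx
  set Ey : Set (BondConfig V) := {ω | ∀ n ∈ N, ¬ (openGraph ω).Reachable y n} with hEy
  set Ez : Set (BondConfig V) := {ω | ∀ n ∈ N, ¬ (openGraph ω).Reachable z n} with hEz
  set Dxz : Set (BondConfig V) := {ω : BondConfig V | ¬ (openGraph ω).Reachable x z} with hDxz
  set Dyz : Set (BondConfig V) := {ω : BondConfig V | ¬ (openGraph ω).Reachable y z} with hDyz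
  set J : Set (BondConfig V) := Ox ∪ Oy with hJ
  -- functions
  set fN : BondConfig V → ℝ := fun ω => F (⋃ n ∈ N, openCluster ω n) with hfN
  set fx : BondConfig V → ℝ := fun ω => F (openCluster ω x) with hfx
  set fy : BondConfig V → ℝ := fun ω => F (openCluster ω y) with hfy
  set fz : BondConfig V → ℝ := fun ω => F (openCluster ω z) with hfz
  -- the weak-relay halves
  have hZx := zhalf_set w x y z N F hF hF0 t lam ht0 ht1 hHx
  have hHy' : ∀ G : Set V → ℝ, (∀ S T : Set V, S ⊆ T → G S ≤ G T) →
      mu * ∫ ω in Dyz, G (openCluster ω y) ∂μ ≤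
        (1 - (1 - t)) * ∫ ω in Oy ∩ (Ex ∩ Ez), G (openCluster ω y) ∂μ +
          (1 - t) * ∫ ω in Oy ∩ Ez, G (openCluster ω y) ∂μ := by
    intro G hG
    have h := hHy G hG
    rw [show (1 - (1 - t)) = t by ring]
    exact h
  have hZy := zhalf_set w y x z N F hF hF0 (1 - t) mu (sub_nonneg.2 ht1) (by linarith) hHy'
  rw [show (1 - (1 - t)) = t by ring] at hZy
  -- the observer halves at `G = F`
  have hOxF := hHx F hF
  have hOyF := hHy F hF
  -- everything as finite sums
  change (1 - t) * ∫ ω in Ox ∩ (Ey ∩ Ez), fz ω ∂μ + t * ∫ ω in Ox ∩ Ez, fz ω ∂μ ≤ lam * ∫ ω in Dxz, fz ω ∂μ at hZx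
  change t * ∫ ω in Oy ∩ (Ex ∩ Ez), fz ω ∂μ + (1 - t) * ∫ ω in Oy ∩ Ez, fz ω ∂μ ≤ mu * ∫ ω in Dyz, fz ω ∂μ at hZy
  change lam * ∫ ω in Dxz, fx ω ∂μ ≤ (1 - t) * ∫ ω in Ox ∩ (Ey ∩ Ez), fx ω ∂μ + t * ∫ ω in Ox ∩ Ez, fx ω ∂μ at hOxF
  change mu * ∫ ω in Dyz, fy ω ∂μ ≤ t * ∫ ω in Oy ∩ (Ex ∩ Ez), fy ω ∂μ + (1 - t) * ∫ ω in Oy ∩ Ez, fy ω ∂μ at hOyF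
  show lam * ((∫ ω, fx ω ∂μ) - ∫ ω, fz ω ∂μ) + mu * ((∫ ω, fy ω ∂μ) - ∫ ω, fz ω ∂μ) ≤
    (∫ ω in J ∩ Ez, fN ω ∂μ) - ∫ ω in J ∩ Ez, fz ω ∂μ
  rw [setIntegral_eq_sum w, setIntegral_eq_sum w, setIntegral_eq_sum w] at hZx hZy hOxF hOyF
  rw [integral_prodBernoulli_eq_sum, integral_prodBernoulli_eq_sum, integral_prodBernoulli_eq_sum,
    setIntegral_eq_sum w, setIntegral_eq_sum w]
  -- pointwise facts
  have hxN : ∀ ω ∈ Ox, fx ω ≤ fN ω := fun ω hω => hF _ _ (openCluster_subset_iUnion_of_reach hω)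
  have hyN : ∀ ω ∈ Oy, fy ω ≤ fN ω := fun ω hω => hF _ _ (openCluster_subset_iUnion_of_reach hω)
  have hzN : ∀ ω, ω ∉ Ez → fz ω ≤ fN ω := by
    intro ω hω
    have h : ∃ n ∈ N, (openGraph ω).Reachable z n := by
      by_contra hcon
      exact hω fun n hn hr => hcon ⟨n, hn, hr⟩
    exact hF _ _ (openCluster_subset_iUnion_of_reach h)
  -- (O): the observer budget, pointwise
  have pO : ∀ ω, wt ω * ((1 - t) * (fx ω * ind (Ox ∩ (Ey ∩ Ez)) ω) + t * (fx ω * ind (Ox ∩ Ez) ω) +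
      t * (fy ω * ind (Oy ∩ (Ex ∩ Ez)) ω) + (1 - t) * (fy ω * ind (Oy ∩ Ez) ω) + 0 * (fN ω * ind (J ∩ Ez) ω)) ≤
      wt ω * (fN ω * ind (J ∩ Ez) ω) := by
    intro ω
    refine mul_le_mul_of_nonneg_left ?_ (hwt0 ω)
    have h1t : 0 ≤ 1 - t := sub_nonneg.2 ht1
    rw [zero_mul, add_zero]
    by_cases hz : ω ∈ Ez
    · by_cases hx : ω ∈ Ox
      · have hJm : ω ∈ J ∩ Ez := ⟨Or.inl hx, hz⟩
        rw [ind_of_mem hJm, ind_of_mem (show ω ∈ Ox ∩ Ez from ⟨hx, hz⟩)]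
        by_cases hy : ω ∈ Oy
        · have hEy' : ω ∉ Ey := fun h => by obtain ⟨n, hn, hr⟩ := hy; exact h n hn hr
          have hEx' : ω ∉ Ex := fun h => by obtain ⟨n, hn, hr⟩ := hx; exact h n hn hr
          rw [ind_of_not_mem (show ω ∉ Ox ∩ (Ey ∩ Ez) from fun h => hEy' h.2.1),
            ind_of_not_mem (show ω ∉ Oy ∩ (Ex ∩ Ez) from fun h => hEx' h.2.1),
            ind_of_mem (show ω ∈ Oy ∩ Ez from ⟨hy, hz⟩)]
          have e1 := mul_le_mul_of_nonneg_left (hxN ω hx) ht0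
          have e2 := mul_le_mul_of_nonneg_left (hyN ω hy) h1t
          simp only [mul_one, mul_zero, zero_add, add_zero]
          linarith
        · have hEy' : ω ∈ Ey := fun n hn hr => hy ⟨n, hn, hr⟩
          rw [ind_of_mem (show ω ∈ Ox ∩ (Ey ∩ Ez) from ⟨hx, hEy', hz⟩),
            ind_of_not_mem (show ω ∉ Oy ∩ (Ex ∩ Ez) from fun h => hy h.1),
            ind_of_not_mem (show ω ∉ Oy ∩ Ez from fun h => hy h.1)]
          have e1 := hxN ω hx
          simp only [mul_one, mul_zero, add_zero]
          nlinarith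
      · rw [ind_of_not_mem (show ω ∉ Ox ∩ (Ey ∩ Ez) from fun h => hx h.1),
          ind_of_not_mem (show ω ∉ Ox ∩ Ez from fun h => hx h.1)]
        by_cases hy : ω ∈ Oy
        · have hJm : ω ∈ J ∩ Ez := ⟨Or.inr hy, hz⟩
          have hEx' : ω ∈ Ex := fun n hn hr => hx ⟨n, hn, hr⟩
          rw [ind_of_mem hJm, ind_of_mem (show ω ∈ Oy ∩ (Ex ∩ Ez) from ⟨hy, hEx', hz⟩),
            ind_of_mem (show ω ∈ Oy ∩ Ez from ⟨hy, hz⟩)]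
          have e1 := hyN ω hy
          simp only [mul_one, mul_zero, zero_add, add_zero]
          nlinarith
        · have hJm : ω ∉ J ∩ Ez := fun h => h.1.elim hx hy
          rw [ind_of_not_mem hJm, ind_of_not_mem (show ω ∉ Oy ∩ (Ex ∩ Ez) from fun h => hy h.1),
            ind_of_not_mem (show ω ∉ Oy ∩ Ez from fun h => hy h.1)]
          simp
    · rw [ind_of_not_mem (show ω ∉ Ox ∩ (Ey ∩ Ez) from fun h => hz h.2.2),
        ind_of_not_mem (show ω ∉ Ox ∩ Ez from fun h => hz h.2),
        ind_of_not_mem (show ω ∉ Oy ∩ (Ex ∩ Ez) from fun h => hz h.2.2),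
        ind_of_not_mem (show ω ∉ Oy ∩ Ez from fun h => hz h.2),
        ind_of_not_mem (show ω ∉ J ∩ Ez from fun h => hz h.2)]
      simp
  -- (Z): the weak-relay mass, pointwise identity, and `C_z ⊆ C_N` on `{z ↔ N}`
  have pZ : ∀ ω, fz ω * ind (J ∩ Ez) ω = (1 - t) * (fz ω * ind (Ox ∩ (Ey ∩ Ez)) ω) + t * (fz ω * ind (Ox ∩ Ez) ω) +
      t * (fz ω * ind (Oy ∩ (Ex ∩ Ez)) ω) + (1 - t) * (fz ω * ind (Oy ∩ Ez) ω) + 0 * (fz ω * ind (J ∩ Ez) ω) := by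
    intro ω
    rw [zero_mul, add_zero]
    by_cases hz : ω ∈ Ez
    · by_cases hx : ω ∈ Ox
      · rw [ind_of_mem (show ω ∈ J ∩ Ez from ⟨Or.inl hx, hz⟩), ind_of_mem (show ω ∈ Ox ∩ Ez from ⟨hx, hz⟩)]
        by_cases hy : ω ∈ Oy
        · have hEy' : ω ∉ Ey := fun h => by obtain ⟨n, hn, hr⟩ := hy; exact h n hn hr
          have hEx' : ω ∉ Ex := fun h => by obtain ⟨n, hn, hr⟩ := hx; exact h n hn hr
          rw [ind_of_not_mem (show ω ∉ Ox ∩ (Ey ∩ Ez) from fun h => hEy' h.2.1),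
            ind_of_not_mem (show ω ∉ Oy ∩ (Ex ∩ Ez) from fun h => hEx' h.2.1),
            ind_of_mem (show ω ∈ Oy ∩ Ez from ⟨hy, hz⟩)]
          ring
        · have hEy' : ω ∈ Ey := fun n hn hr => hy ⟨n, hn, hr⟩
          rw [ind_of_mem (show ω ∈ Ox ∩ (Ey ∩ Ez) from ⟨hx, hEy', hz⟩),
            ind_of_not_mem (show ω ∉ Oy ∩ (Ex ∩ Ez) from fun h => hy h.1),
            ind_of_not_mem (show ω ∉ Oy ∩ Ez from fun h => hy h.1)]
          ring
      · rw [ind_of_not_mem (show ω ∉ Ox ∩ (Ey ∩ Ez) from fun h => hx h.1),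
          ind_of_not_mem (show ω ∉ Ox ∩ Ez from fun h => hx h.1)]
        by_cases hy : ω ∈ Oy
        · have hEx' : ω ∈ Ex := fun n hn hr => hx ⟨n, hn, hr⟩
          rw [ind_of_mem (show ω ∈ J ∩ Ez from ⟨Or.inr hy, hz⟩),
            ind_of_mem (show ω ∈ Oy ∩ (Ex ∩ Ez) from ⟨hy, hEx', hz⟩), ind_of_mem (show ω ∈ Oy ∩ Ez from ⟨hy, hz⟩)]
          ring
        · rw [ind_of_not_mem (show ω ∉ J ∩ Ez from fun h => h.1.elim hx hy),
            ind_of_not_mem (show ω ∉ Oy ∩ (Ex ∩ Ez) from fun h => hy h.1),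
            ind_of_not_mem (show ω ∉ Oy ∩ Ez from fun h => hy h.1)]
          ring
    · rw [ind_of_not_mem (show ω ∉ Ox ∩ (Ey ∩ Ez) from fun h => hz h.2.2),
        ind_of_not_mem (show ω ∉ Ox ∩ Ez from fun h => hz h.2),
        ind_of_not_mem (show ω ∉ Oy ∩ (Ex ∩ Ez) from fun h => hz h.2.2),
        ind_of_not_mem (show ω ∉ Oy ∩ Ez from fun h => hz h.2),
        ind_of_not_mem (show ω ∉ J ∩ Ez from fun h => hz h.2)]
      ring
  -- (D): designation transferred to `{x ↮ z}` (resp. `{y ↮ z}`): off these events the clusters coincide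
  have pDx : ∀ ω, wt ω * fx ω - wt ω * (fx ω * ind Dxz ω) = wt ω * fz ω - wt ω * (fz ω * ind Dxz ω) := by
    intro ω
    by_cases h : ω ∈ Dxz
    · rw [ind_of_mem h, mul_one, mul_one, sub_self, sub_self]
    · have hxz : (openGraph ω).Reachable x z := not_not.1 h
      rw [ind_of_not_mem h]
      simp only [mul_zero, sub_zero, hfx, hfz, openCluster_eq_of_reachable hxz]
  have pDy : ∀ ω, wt ω * fy ω - wt ω * (fy ω * ind Dyz ω) = wt ω * fz ω - wt ω * (fz ω * ind Dyz ω) := by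
    intro ω
    by_cases h : ω ∈ Dyz
    · rw [ind_of_mem h, mul_one, mul_one, sub_self, sub_self]
    · have hyz : (openGraph ω).Reachable y z := not_not.1 h
      rw [ind_of_not_mem h]
      simp only [mul_zero, sub_zero, hfy, hfz, openCluster_eq_of_reachable hyz]
  -- sum the pointwise facts
  have sO := Finset.sum_le_sum fun ω (_ : ω ∈ Finset.univ) => pO ω
  have sDx : ∑ ω, wt ω * fx ω - ∑ ω, wt ω * (fx ω * ind Dxz ω) =
      ∑ ω, wt ω * fz ω - ∑ ω, wt ω * (fz ω * ind Dxz ω) := by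
    rw [← Finset.sum_sub_distrib, ← Finset.sum_sub_distrib]
    exact Finset.sum_congr rfl fun ω _ => pDx ω
  have sDy : ∑ ω, wt ω * fy ω - ∑ ω, wt ω * (fy ω * ind Dyz ω) =
      ∑ ω, wt ω * fz ω - ∑ ω, wt ω * (fz ω * ind Dyz ω) := by
    rw [← Finset.sum_sub_distrib, ← Finset.sum_sub_distrib]
    exact Finset.sum_congr rfl fun ω _ => pDy ω
  rw [sum_lin5 wt _ (fun ω => fx ω * ind (Ox ∩ (Ey ∩ Ez)) ω) (fun ω => fx ω * ind (Ox ∩ Ez) ω)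
    (fun ω => fy ω * ind (Oy ∩ (Ex ∩ Ez)) ω) (fun ω => fy ω * ind (Oy ∩ Ez) ω) (fun ω => fN ω * ind (J ∩ Ez) ω)
    (1 - t) t t (1 - t) 0 (fun ω => rfl)] at sO
  have sZ := sum_lin5 wt (fun ω => fz ω * ind (J ∩ Ez) ω) (fun ω => fz ω * ind (Ox ∩ (Ey ∩ Ez)) ω)
    (fun ω => fz ω * ind (Ox ∩ Ez) ω) (fun ω => fz ω * ind (Oy ∩ (Ex ∩ Ez)) ω) (fun ω => fz ω * ind (Oy ∩ Ez) ω)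
    (fun ω => fz ω * ind (J ∩ Ez) ω) (1 - t) t t (1 - t) 0 pZ
  -- `λ (TX − TZ) = λ (DX − DZx)` and the same for `μ`
  have plx : lam * ∑ ω, wt ω * fx ω - lam * ∑ ω, wt ω * fz ω =
      lam * ∑ ω, wt ω * (fx ω * ind Dxz ω) - lam * ∑ ω, wt ω * (fz ω * ind Dxz ω) := by
    rw [← mul_sub, ← mul_sub]; congr 1; linarith
  have pmy : mu * ∑ ω, wt ω * fy ω - mu * ∑ ω, wt ω * fz ω =
      mu * ∑ ω, wt ω * (fy ω * ind Dyz ω) - mu * ∑ ω, wt ω * (fz ω * ind Dyz ω) := by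
    rw [← mul_sub, ← mul_sub]; congr 1; linarith
  rw [mul_sub, mul_sub]
  linarith

end Q7Psi

end

end Summit.CriticalPhenomena.PercolationContinuityZ3.Theorems
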